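import Literature.AnabelianGeometry.EtaleTheta.Discharge.Sec3HQOfRationalSupportWeak
import Literature.AnabelianGeometry.EtaleTheta.Discharge.Sec3Cor38iWeak
import Literature.AnabelianGeometry.EtaleTheta.Discharge.Sec3BLambdaInjectiveOfRlf
import HarnessLib

/-!
# [EtTh] Corollary 3.8 (i) AS TYPED over the WEAK canonical monoid vocabulary from print-level clauses only:
# the criterion C38-L05 consumed from RATIONAL SUPPORT, also at the constructed `Ÿ` / `Z_∞`-type data

S. Mochizuki, *The étale theta function and its Frobenioid-theoretic manifestations*, Publ. RIMS **45** (2009),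
Cor. 3.8 (i), statement PDF p. 80, proof p. 81 l. 13–32 [cite: MochizukiEtTh2009, Cor 3.8 p.81]; Def. 3.6 (i)/(ii)
pp. 76–77, Remark 3.3.1 p. 73, Prop. 3.4 (ii) p. 74; S. Mochizuki, *The geometry of Frobenioids I* (2008), Def. 2.4
(i) pp. 47–48 [cite: MochizukiFrdI2008, Def. 2.4(i) p.47].

abc-iut cell, layer L2, cone node `EtTh:Cor3.8(i)` (kernel id `N_EtTh_Cor3_8_i`), seat abc-iut-w6-d039 (gen 3);
PROOF-ONLY sequel (0 definitions) of this lineage's `Discharge/Sec3Cor38iWeak.lean` (p439433: the node closer at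
the WEAK vocabulary with the criteria as binders / from abc-iut-w4-d084's `…_of_coordWeak`, inputs `hF`, `hP34Λ`,
`hNZ`, `hQ`) over abc-iut-L6-t12's `Discharge/Sec3HQOfRationalSupportWeak.lean` (p438882, W7: the binder `hQ` of
row C38-L05 DERIVED at the weak vocabulary from (hZQ) "every prime of `Φ₀(Y_W)` is a `ℤ`- or `ℚ`-prime" and (hsat)
"`Φ(W)` has rational support in `Φ₀^ℝ(Y_W)`", and the criterion at the weak constructed data `ofRlfZWeak` /
`ofRlfQWeak` from `B₀`/`Φ₀`-level statements).

WHY.  Cell finding F-L2d2-1 (abc-iut-L2-d2): the tempered coverings `Ÿ`, `Z_∞` of [EtTh] §§4–5 have infinitely many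
special-fibre components, `Φ₀(Y^log) ⊇ ∏_j ℤ_{≥0}` is only WEAKLY perf-factorial, and their Def. 3.3 (iii) / 3.6
(i) data are typed over `treeMonoidVocabWeak` (constructors `RealifiedDivisorMonoids.ofRlfZWeak` / `ofRlfQWeak`).
With this file Cor. 3.8 (i) AS TYPED has, at BOTH canonical monoid vocabularies and at BOTH families of constructed
data, node-level closers with the SAME print-level input lists (strong twins: this lineage's
`cor38_i_of_ratSupport` / `cor38_i_canonical_of_structural` / `cor38_i_ofRlfZ_of_ratSupport` / `…_of_structural`,
p438712):

* §1 `Cor38Hyp.cor38_i_weak_of_ratSupport` (any category vocabularies; the weak data `T_i`, `C_i` are bound IN the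
  statement, so that it is not textually its strong twin): inputs `hF_i` ([FrdI] Thm. 5.2 (ii)) and,
  per side, `hP34Λ_i` (Prop. 3.4 (ii) at monoid type `Λ`), `hNZ_i` (Def. 3.6 (ii)(b)), `hZQ_i` (Rmk. 3.3.1),
  `hsat_i` (Def. 3.6 (i)/(ii): rational support);
* §2 `Cor38Hyp.cor38_i_weak_of_ratSupport_of_structural` (canonical category vocabulary): `hBinj_i`, `hFSM_i`
  (⟹ `hF_i`, abc-iut-L2-t3's `isFrobenioid_of_structural`), `hP_i : T_i.Prop34Cnst cnst_i` (⟹ `hP34Λ_i`),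
  `hNZ_i`, `hZQ_i`, `hsat_i` — every input a named print-level clause;
* §3 at the weak CONSTRUCTED data of monoid type `ℤ` / `ℚ`: `Cor38Hyp.cor38_i_ofRlfZWeak_of_ratSupport` /
  `…_ofRlfQWeak_of_ratSupport` (any category vocabularies; inputs `hF_i`, `dm_i.Prop34`, `hcyc_i`, `hZQ_i`,
  `hsat_i` — `B₀`/`Φ₀`-level statements only), `…_of_prop34Const` (`hcyc_i` ⟸ abc-iut-L2-t3's binder of record
  `dm_i.Prop34Const`), and `…_of_structural` (canonical category vocabulary: `hB₀inj_i`, `hFSM_i` through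
  abc-iut-L2-t3's `RealifiedDivisorMonoids.ofRlfZWeak_hBinj` / `ofRlfQWeak_hBinj`).

Nothing of abc-iut-L6-t12 / w4-d084 / w5-d130 / L2-d2 / L2-t3 is re-derived; no statement of print is
strengthened: `hsat`, `hcyc`, `hNZ`, `hZQ` are print's standing situation for the geometric data and NOT derivable
from the typed interfaces (kernel certificates `ToyHNZ` p427694, `Sec3Cor38CriterionToy` p425444,
`Sec3Cor38iStatementToy` p432851).  HONEST FRAMING: refereed pre-IUT material ([EtTh] §3 over [FrdI] §§2–5);
nothing here bears on [IUTchIII] Cor. 3.12; no side taken; typed ≠ proved — here proved modulo the named binders.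
-/

noncomputable section

namespace Literature.AnabelianGeometry.EtaleTheta

open CategoryTheory Opposite Function Literature.AlgebraicGeometry.Frobenioids

universe u₀ v₀ u v w u₁ v₁

namespace Cor38Hyp

/-! ## §1 Weak canonical monoid vocabulary, arbitrary category vocabularies -/

section Weak

variable {D₀ : Type u₀} [Category.{v₀} D₀] {D₀' : Type u₀} [Category.{v₀} D₀']
  {D : Type u} [Category.{v} D] {D' : Type u} [Category.{v} D']
  {VD : FrdICatStub.{u, v, w} D} {VD' : FrdICatStub.{u, v, w} D'}

/-- **[EtTh] Cor. 3.8 (i) AS TYPED over the WEAK canonical monoid vocabulary, ANY category vocabularies, the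
criterion C38-L05 consumed from rational support** — the weak twin of this lineage's `cor38_i_of_ratSupport`
(p438712) with the SAME input list: `hF_i` ([FrdI] Thm. 5.2 (ii)) and, per side, `hP34Λ_i` (Prop. 3.4 (ii) at
monoid type `Λ`), `hNZ_i` (Def. 3.6 (ii)(b)), `hZQ_i` (Rmk. 3.3.1), `hsat_i` (Def. 3.6 (i)/(ii): rational support);
C38-L05 := abc-iut-L6-t12's `bsFldPreStepLimitCriterion_of_ratSupport_weak`, the rest := `cor38_i_weak_of_criteria`
(row C38-L01 and [FrdI] Thm. 3.4 (ii) tree theorems). [cite: MochizukiEtTh2009, Cor 3.8 p.80] -/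
theorem cor38_i_weak_of_ratSupport
    {T : RealifiedDivisorMonoids (D₀ := D₀) treeMonoidVocabWeak.{w}}
    {T' : RealifiedDivisorMonoids (D₀ := D₀') treeMonoidVocabWeak.{w}}
    {C₁ : TemperedFrobenioid T D VD} {C₂ : TemperedFrobenioid T' D' VD'} (h : Cor38Hyp C₁ C₂)
    (hF₁ : PreFrobenioid.IsFrobenioid C₁.toElem) (hF₂ : PreFrobenioid.IsFrobenioid C₂.toElem)
    (hP34Λ₁ : ∀ (Y : D₀ᵒᵖ) (b : T.BΛ.obj Y) (r : T.ΦR.obj Y),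
      T.divΛ Y b = Algebra.GrothendieckGroup.of r → b ∈ T.FΛ Y)
    (hNZ₁ : ∀ A : Dᵒᵖ, ∃ u : (T.BΛ.obj (C₁.baseOp A) : Type w) × Algebra.GrothendieckGroup (C₁.Φ.carrier A),
      u ∈ C₁.cnstFn A ∧ ∃ Z : C₁.Φ.carrier A, Z ≠ 1 ∧ u.2 = Algebra.GrothendieckGroup.of Z)
    (hZQ₁ : ∀ (W : D) (𝔭 : Primes (T.Φ₀.obj (C₁.baseOp (op W)))),
      IsZMonoprime ↥𝔭.submonoid ∨ IsQMonoprime ↥𝔭.submonoid)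
    (hsat₁ : ∀ (W : D), ∀ x ∈ C₁.Φ.carrier (op W), ∃ (N : ℕ+) (d : T.Φ₀.obj (C₁.baseOp (op W))),
      x ^ (N : ℕ) = T.toR (C₁.baseOp (op W)) d)
    (hP34Λ₂ : ∀ (Y : D₀'ᵒᵖ) (b : T'.BΛ.obj Y) (r : T'.ΦR.obj Y),
      T'.divΛ Y b = Algebra.GrothendieckGroup.of r → b ∈ T'.FΛ Y)
    (hNZ₂ : ∀ A : D'ᵒᵖ, ∃ u : (T'.BΛ.obj (C₂.baseOp A) : Type w) × Algebra.GrothendieckGroup (C₂.Φ.carrier A),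
      u ∈ C₂.cnstFn A ∧ ∃ Z : C₂.Φ.carrier A, Z ≠ 1 ∧ u.2 = Algebra.GrothendieckGroup.of Z)
    (hZQ₂ : ∀ (W : D') (𝔭 : Primes (T'.Φ₀.obj (C₂.baseOp (op W)))),
      IsZMonoprime ↥𝔭.submonoid ∨ IsQMonoprime ↥𝔭.submonoid)
    (hsat₂ : ∀ (W : D'), ∀ x ∈ C₂.Φ.carrier (op W), ∃ (N : ℕ+) (d : T'.Φ₀.obj (C₂.baseOp (op W))),
      x ^ (N : ℕ) = T'.toR (C₂.baseOp (op W)) d) :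
    Literature.AnabelianGeometry.EtaleTheta.Cor38_i
      (fun E _ => Literature.AlgebraicGeometry.Frobenioids.IsFrobeniusSlim E) h :=
  h.cor38_i_weak_of_criteria hF₁ hF₂
    (C₁.bsFldPreStepLimitCriterion_of_ratSupport_weak hF₁ hP34Λ₁ hNZ₁ hZQ₁ hsat₁)
    (C₂.bsFldPreStepLimitCriterion_of_ratSupport_weak hF₂ hP34Λ₂ hNZ₂ hZQ₂ hsat₂)

end Weak

/-! ## §2 Weak monoid vocabulary at the canonical category vocabulary `treeCatVocab` -/

section WeakCanonical

variable {D₀ : Type u₀} [Category.{v₀} D₀] {D₀' : Type u₀} [Category.{v₀} D₀']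
  {D : Type u} [Category.{v} D] {D' : Type u} [Category.{v} D']
  {IsRational IsStrictlyRational : (Dᵒᵖ ⥤ CommMonCat.{w}) → Prop}
  {IsRational' IsStrictlyRational' : (D'ᵒᵖ ⥤ CommMonCat.{w}) → Prop}

/-- **[EtTh] Cor. 3.8 (i) AS TYPED over the WEAK monoid vocabulary at the canonical category vocabulary from NAMED
PRINT-LEVEL CLAUSES ONLY** — the weak twin of `cor38_i_canonical_of_structural` (p438712) with the same input list
per side: `hBinj_i`, `hFSM_i` (⟹ `hF_i`, abc-iut-L2-t3's `isFrobenioid_of_structural`),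
`hP_i : T_i.Prop34Cnst cnst_i` (⟹ `hP34Λ_i`), `hNZ_i`, `hZQ_i`, `hsat_i`. [cite: MochizukiEtTh2009, Cor 3.8 p.80] -/
theorem cor38_i_weak_of_ratSupport_of_structural
    {T : RealifiedDivisorMonoids (D₀ := D₀) treeMonoidVocabWeak.{w}}
    {T' : RealifiedDivisorMonoids (D₀ := D₀') treeMonoidVocabWeak.{w}}
    {C₁ : TemperedFrobenioid T D (treeCatVocab D IsRational IsStrictlyRational)}
    {C₂ : TemperedFrobenioid T' D' (treeCatVocab D' IsRational' IsStrictlyRational')} (h : Cor38Hyp C₁ C₂)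
    {Dcnst : Type u₁} [Category.{v₁} Dcnst] {cnst : D₀ ⥤ Dcnst}
    {Dcnst' : Type u₁} [Category.{v₁} Dcnst'] {cnst' : D₀' ⥤ Dcnst'}
    (hBinj₁ : ∀ {Y Y' : D₀ᵒᵖ} (g : Y ⟶ Y'), Injective (T.BΛ.map g).hom)
    (hFSM₁ : ∀ {A B : D} (α : B ⟶ A), IsFSM α → IsIso α)
    (hP₁ : T.Prop34Cnst cnst)
    (hNZ₁ : ∀ A : Dᵒᵖ, ∃ u : (T.BΛ.obj (C₁.baseOp A) : Type w) × Algebra.GrothendieckGroup (C₁.Φ.carrier A),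
      u ∈ C₁.cnstFn A ∧ ∃ Z : C₁.Φ.carrier A, Z ≠ 1 ∧ u.2 = Algebra.GrothendieckGroup.of Z)
    (hZQ₁ : ∀ (W : D) (𝔭 : Primes (T.Φ₀.obj (C₁.baseOp (op W)))),
      IsZMonoprime ↥𝔭.submonoid ∨ IsQMonoprime ↥𝔭.submonoid)
    (hsat₁ : ∀ (W : D), ∀ x ∈ C₁.Φ.carrier (op W), ∃ (N : ℕ+) (d : T.Φ₀.obj (C₁.baseOp (op W))),
      x ^ (N : ℕ) = T.toR (C₁.baseOp (op W)) d)
    (hBinj₂ : ∀ {Y Y' : D₀'ᵒᵖ} (g : Y ⟶ Y'), Injective (T'.BΛ.map g).hom)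
    (hFSM₂ : ∀ {A B : D'} (α : B ⟶ A), IsFSM α → IsIso α)
    (hP₂ : T'.Prop34Cnst cnst')
    (hNZ₂ : ∀ A : D'ᵒᵖ, ∃ u : (T'.BΛ.obj (C₂.baseOp A) : Type w) × Algebra.GrothendieckGroup (C₂.Φ.carrier A),
      u ∈ C₂.cnstFn A ∧ ∃ Z : C₂.Φ.carrier A, Z ≠ 1 ∧ u.2 = Algebra.GrothendieckGroup.of Z)
    (hZQ₂ : ∀ (W : D') (𝔭 : Primes (T'.Φ₀.obj (C₂.baseOp (op W)))),
      IsZMonoprime ↥𝔭.submonoid ∨ IsQMonoprime ↥𝔭.submonoid)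
    (hsat₂ : ∀ (W : D'), ∀ x ∈ C₂.Φ.carrier (op W), ∃ (N : ℕ+) (d : T'.Φ₀.obj (C₂.baseOp (op W))),
      x ^ (N : ℕ) = T'.toR (C₂.baseOp (op W)) d) :
    Literature.AnabelianGeometry.EtaleTheta.Cor38_i
      (fun E _ => Literature.AlgebraicGeometry.Frobenioids.IsFrobeniusSlim E) h :=
  h.cor38_i_weak_of_ratSupport (C₁.isFrobenioid_of_structural hBinj₁ hFSM₁)
    (C₂.isFrobenioid_of_structural hBinj₂ hFSM₂) hP₁.mem_FΛ_of_divΛ_eq_of hNZ₁ hZQ₁ hsat₁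
    hP₂.mem_FΛ_of_divΛ_eq_of hNZ₂ hZQ₂ hsat₂

end WeakCanonical

/-! ## §3 Both tempered Frobenioids over the weak CONSTRUCTED Def. 3.6 (i) data `ofRlfZWeak` / `ofRlfQWeak` -/

section OfRlfWeak

variable {D₀ : Type u₀} [Category.{v₀} D₀] {dm₁ : DivisorMonoids.{u₀, v₀, w} D₀}
  {hpf₁ : ∀ Y : D₀ᵒᵖ, IsPerfFactorialCof (dm₁.Φ₀.obj Y)}
  {V₁ : FrdIMonoidStub.{w}} {V₀₁ : FrdICatStub.{u₀, v₀, w} D₀}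
  {D₀' : Type u₀} [Category.{v₀} D₀'] {dm₂ : DivisorMonoids.{u₀, v₀, w} D₀'}
  {hpf₂ : ∀ Y : D₀'ᵒᵖ, IsPerfFactorialCof (dm₂.Φ₀.obj Y)}
  {V₂ : FrdIMonoidStub.{w}} {V₀₂ : FrdICatStub.{u₀, v₀, w} D₀'}
  {D : Type u} [Category.{v} D] {D' : Type u} [Category.{v} D']
  {VD : FrdICatStub.{u, v, w} D} {VD' : FrdICatStub.{u, v, w} D'}
  {IsRational IsStrictlyRational : (Dᵒᵖ ⥤ CommMonCat.{w}) → Prop}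
  {IsRational' IsStrictlyRational' : (D'ᵒᵖ ⥤ CommMonCat.{w}) → Prop}

/-- **[EtTh] Cor. 3.8 (i) AS TYPED for two tempered Frobenioids over the WEAK constructed Def. 3.6 (i) data of
monoid type `ℤ`** (`RealifiedDivisorMonoids.ofRlfZWeak dm hpf`: `B₀^ℤ = B₀`, `F₀^ℤ = F₀`, `Φ₀^ℝ` = the weak
realification of `Φ₀ ⊇ ∏_j ℤ_{≥0}` — the `Ÿ` / `Z_∞`-type data of F-L2d2-1), ANY category vocabularies, modulo `hF_i`
([FrdI] Thm. 5.2 (ii)) and `B₀`/`Φ₀`-LEVEL PRINT STATEMENTS ONLY: `dm_i.Prop34` (the typed Prop. 3.4 structure),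
`hcyc_i` (Def. 3.6 (ii)(b): the divisors of constants at `Y` are integral powers of one effective divisor), `hZQ_i`
(Rmk. 3.3.1), `hsat_i` (rational support of `Φ_i(W)` in `Φ₀(Y_W)^rlf`) — C38-L05 by abc-iut-L6-t12's
`bsFldPreStepLimitCriterion_ofRlfZWeak_of_ratSupport` (`hP34Λ`, `hNZ`, `hQ` derived there).
[cite: MochizukiEtTh2009, Cor 3.8 p.80] -/
theorem cor38_i_ofRlfZWeak_of_ratSupport
    {C₁ : TemperedFrobenioid (RealifiedDivisorMonoids.ofRlfZWeak dm₁ hpf₁) D VD}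
    {C₂ : TemperedFrobenioid (RealifiedDivisorMonoids.ofRlfZWeak dm₂ hpf₂) D' VD'}
    (h : Cor38Hyp C₁ C₂)
    (hF₁ : PreFrobenioid.IsFrobenioid C₁.toElem) (hF₂ : PreFrobenioid.IsFrobenioid C₂.toElem)
    (h34₁ : dm₁.Prop34 V₁ V₀₁)
    (hcyc₁ : ∀ Y : D₀ᵒᵖ, ∃ d : dm₁.Φ₀.obj Y, ∀ b ∈ dm₁.F₀ Y, ∃ n : ℤ,
      dm₁.div₀ Y b = Algebra.GrothendieckGroup.of d ^ n)
    (hZQ₁ : ∀ (W : D) (𝔭 : Primes (dm₁.Φ₀.obj (C₁.baseOp (op W)))),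
      IsZMonoprime ↥𝔭.submonoid ∨ IsQMonoprime ↥𝔭.submonoid)
    (hsat₁ : ∀ (W : D), ∀ x ∈ C₁.Φ.carrier (op W), ∃ (N : ℕ+) (d : dm₁.Φ₀.obj (C₁.baseOp (op W))),
      x ^ (N : ℕ) = (hpf₁ (C₁.baseOp (op W))).weak.toRealification (Perfection.of _ d))
    (h34₂ : dm₂.Prop34 V₂ V₀₂)
    (hcyc₂ : ∀ Y : D₀'ᵒᵖ, ∃ d : dm₂.Φ₀.obj Y, ∀ b ∈ dm₂.F₀ Y, ∃ n : ℤ,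
      dm₂.div₀ Y b = Algebra.GrothendieckGroup.of d ^ n)
    (hZQ₂ : ∀ (W : D') (𝔭 : Primes (dm₂.Φ₀.obj (C₂.baseOp (op W)))),
      IsZMonoprime ↥𝔭.submonoid ∨ IsQMonoprime ↥𝔭.submonoid)
    (hsat₂ : ∀ (W : D'), ∀ x ∈ C₂.Φ.carrier (op W), ∃ (N : ℕ+) (d : dm₂.Φ₀.obj (C₂.baseOp (op W))),
      x ^ (N : ℕ) = (hpf₂ (C₂.baseOp (op W))).weak.toRealification (Perfection.of _ d)) :
    Literature.AnabelianGeometry.EtaleTheta.Cor38_i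
      (fun E _ => Literature.AlgebraicGeometry.Frobenioids.IsFrobeniusSlim E) h :=
  h.cor38_i_weak_of_criteria hF₁ hF₂
    (C₁.bsFldPreStepLimitCriterion_ofRlfZWeak_of_ratSupport hF₁ h34₁ hcyc₁ hZQ₁ hsat₁)
    (C₂.bsFldPreStepLimitCriterion_ofRlfZWeak_of_ratSupport hF₂ h34₂ hcyc₂ hZQ₂ hsat₂)

/-- The same with `hcyc_i` read from abc-iut-L2-t3's binder of record `dm_i.Prop34Const` ([EtTh] Prop. 3.4 (ii),
third isomorphism `F₀(Y) ≅ L^×` with `div(ϖ_L)`). [cite: MochizukiEtTh2009, Cor 3.8 p.80] -/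
theorem cor38_i_ofRlfZWeak_of_ratSupport_of_prop34Const
    {C₁ : TemperedFrobenioid (RealifiedDivisorMonoids.ofRlfZWeak dm₁ hpf₁) D VD}
    {C₂ : TemperedFrobenioid (RealifiedDivisorMonoids.ofRlfZWeak dm₂ hpf₂) D' VD'}
    (h : Cor38Hyp C₁ C₂)
    (hF₁ : PreFrobenioid.IsFrobenioid C₁.toElem) (hF₂ : PreFrobenioid.IsFrobenioid C₂.toElem)
    (h34₁ : dm₁.Prop34 V₁ V₀₁) (hC₁ : dm₁.Prop34Const)
    (hZQ₁ : ∀ (W : D) (𝔭 : Primes (dm₁.Φ₀.obj (C₁.baseOp (op W)))),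
      IsZMonoprime ↥𝔭.submonoid ∨ IsQMonoprime ↥𝔭.submonoid)
    (hsat₁ : ∀ (W : D), ∀ x ∈ C₁.Φ.carrier (op W), ∃ (N : ℕ+) (d : dm₁.Φ₀.obj (C₁.baseOp (op W))),
      x ^ (N : ℕ) = (hpf₁ (C₁.baseOp (op W))).weak.toRealification (Perfection.of _ d))
    (h34₂ : dm₂.Prop34 V₂ V₀₂) (hC₂ : dm₂.Prop34Const)
    (hZQ₂ : ∀ (W : D') (𝔭 : Primes (dm₂.Φ₀.obj (C₂.baseOp (op W)))),
      IsZMonoprime ↥𝔭.submonoid ∨ IsQMonoprime ↥𝔭.submonoid)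
    (hsat₂ : ∀ (W : D'), ∀ x ∈ C₂.Φ.carrier (op W), ∃ (N : ℕ+) (d : dm₂.Φ₀.obj (C₂.baseOp (op W))),
      x ^ (N : ℕ) = (hpf₂ (C₂.baseOp (op W))).weak.toRealification (Perfection.of _ d)) :
    Literature.AnabelianGeometry.EtaleTheta.Cor38_i
      (fun E _ => Literature.AlgebraicGeometry.Frobenioids.IsFrobeniusSlim E) h :=
  h.cor38_i_ofRlfZWeak_of_ratSupport hF₁ hF₂ h34₁ hC₁.hcyc hZQ₁ hsat₁ h34₂ hC₂.hcyc hZQ₂ hsat₂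

/-- **[EtTh] Cor. 3.8 (i) AS TYPED over the weak constructed `Λ = ℤ` data from NAMED `B₀`/`Φ₀`/`D`-LEVEL CLAUSES
ONLY** (canonical category vocabulary): `hF_i` ⟸ (`hB₀inj_i`, `hFSM_i`) through abc-iut-L2-t3's
`isFrobenioid_of_structural` ∘ `RealifiedDivisorMonoids.ofRlfZWeak_hBinj` (pull-backs of `B₀` injective: "the function
field of a connected covering embeds in that of a covering above it", Def. 3.3 (iii); FSM-morphisms of `D_i` are
isomorphisms).  Inputs per side: `hB₀inj_i`, `hFSM_i`, `dm_i.Prop34`, `hcyc_i`, `hZQ_i`, `hsat_i`.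
[cite: MochizukiEtTh2009, Cor 3.8 p.80] -/
theorem cor38_i_ofRlfZWeak_of_structural
    {C₁ : TemperedFrobenioid (RealifiedDivisorMonoids.ofRlfZWeak dm₁ hpf₁) D
      (treeCatVocab D IsRational IsStrictlyRational)}
    {C₂ : TemperedFrobenioid (RealifiedDivisorMonoids.ofRlfZWeak dm₂ hpf₂) D'
      (treeCatVocab D' IsRational' IsStrictlyRational')}
    (h : Cor38Hyp C₁ C₂)
    (hB₀inj₁ : ∀ {Y Y' : D₀ᵒᵖ} (g : Y ⟶ Y'), Injective (dm₁.B₀.map g).hom)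
    (hFSM₁ : ∀ {A B : D} (α : B ⟶ A), IsFSM α → IsIso α)
    (h34₁ : dm₁.Prop34 V₁ V₀₁)
    (hcyc₁ : ∀ Y : D₀ᵒᵖ, ∃ d : dm₁.Φ₀.obj Y, ∀ b ∈ dm₁.F₀ Y, ∃ n : ℤ,
      dm₁.div₀ Y b = Algebra.GrothendieckGroup.of d ^ n)
    (hZQ₁ : ∀ (W : D) (𝔭 : Primes (dm₁.Φ₀.obj (C₁.baseOp (op W)))),
      IsZMonoprime ↥𝔭.submonoid ∨ IsQMonoprime ↥𝔭.submonoid)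
    (hsat₁ : ∀ (W : D), ∀ x ∈ C₁.Φ.carrier (op W), ∃ (N : ℕ+) (d : dm₁.Φ₀.obj (C₁.baseOp (op W))),
      x ^ (N : ℕ) = (hpf₁ (C₁.baseOp (op W))).weak.toRealification (Perfection.of _ d))
    (hB₀inj₂ : ∀ {Y Y' : D₀'ᵒᵖ} (g : Y ⟶ Y'), Injective (dm₂.B₀.map g).hom)
    (hFSM₂ : ∀ {A B : D'} (α : B ⟶ A), IsFSM α → IsIso α)
    (h34₂ : dm₂.Prop34 V₂ V₀₂)
    (hcyc₂ : ∀ Y : D₀'ᵒᵖ, ∃ d : dm₂.Φ₀.obj Y, ∀ b ∈ dm₂.F₀ Y, ∃ n : ℤ,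
      dm₂.div₀ Y b = Algebra.GrothendieckGroup.of d ^ n)
    (hZQ₂ : ∀ (W : D') (𝔭 : Primes (dm₂.Φ₀.obj (C₂.baseOp (op W)))),
      IsZMonoprime ↥𝔭.submonoid ∨ IsQMonoprime ↥𝔭.submonoid)
    (hsat₂ : ∀ (W : D'), ∀ x ∈ C₂.Φ.carrier (op W), ∃ (N : ℕ+) (d : dm₂.Φ₀.obj (C₂.baseOp (op W))),
      x ^ (N : ℕ) = (hpf₂ (C₂.baseOp (op W))).weak.toRealification (Perfection.of _ d)) :
    Literature.AnabelianGeometry.EtaleTheta.Cor38_i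
      (fun E _ => Literature.AlgebraicGeometry.Frobenioids.IsFrobeniusSlim E) h :=
  h.cor38_i_ofRlfZWeak_of_ratSupport
    (C₁.isFrobenioid_of_structural (RealifiedDivisorMonoids.ofRlfZWeak_hBinj dm₁ hpf₁ hB₀inj₁) hFSM₁)
    (C₂.isFrobenioid_of_structural (RealifiedDivisorMonoids.ofRlfZWeak_hBinj dm₂ hpf₂ hB₀inj₂) hFSM₂)
    h34₁ hcyc₁ hZQ₁ hsat₁ h34₂ hcyc₂ hZQ₂ hsat₂

/-- **[EtTh] Cor. 3.8 (i) AS TYPED for two tempered Frobenioids over the WEAK constructed Def. 3.6 (i) data of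
monoid type `ℚ`** (`RealifiedDivisorMonoids.ofRlfQWeak dm hpf`: `B₀^ℚ = B₀^pf`, `F₀^ℚ = F₀^pf`, same weak `Φ₀^ℝ`),
any category vocabularies, modulo `hF_i` and the same `B₀`/`Φ₀`-level print statements `dm_i.Prop34`, `hcyc_i`,
`hZQ_i`, `hsat_i` (C38-L05 by abc-iut-L6-t12's `bsFldPreStepLimitCriterion_ofRlfQWeak_of_ratSupport`).
[cite: MochizukiEtTh2009, Cor 3.8 p.80] -/
theorem cor38_i_ofRlfQWeak_of_ratSupport
    {C₁ : TemperedFrobenioid (RealifiedDivisorMonoids.ofRlfQWeak dm₁ hpf₁) D VD}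
    {C₂ : TemperedFrobenioid (RealifiedDivisorMonoids.ofRlfQWeak dm₂ hpf₂) D' VD'}
    (h : Cor38Hyp C₁ C₂)
    (hF₁ : PreFrobenioid.IsFrobenioid C₁.toElem) (hF₂ : PreFrobenioid.IsFrobenioid C₂.toElem)
    (h34₁ : dm₁.Prop34 V₁ V₀₁)
    (hcyc₁ : ∀ Y : D₀ᵒᵖ, ∃ d : dm₁.Φ₀.obj Y, ∀ b ∈ dm₁.F₀ Y, ∃ n : ℤ,
      dm₁.div₀ Y b = Algebra.GrothendieckGroup.of d ^ n)
    (hZQ₁ : ∀ (W : D) (𝔭 : Primes (dm₁.Φ₀.obj (C₁.baseOp (op W)))),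
      IsZMonoprime ↥𝔭.submonoid ∨ IsQMonoprime ↥𝔭.submonoid)
    (hsat₁ : ∀ (W : D), ∀ x ∈ C₁.Φ.carrier (op W), ∃ (N : ℕ+) (d : dm₁.Φ₀.obj (C₁.baseOp (op W))),
      x ^ (N : ℕ) = (hpf₁ (C₁.baseOp (op W))).weak.toRealification (Perfection.of _ d))
    (h34₂ : dm₂.Prop34 V₂ V₀₂)
    (hcyc₂ : ∀ Y : D₀'ᵒᵖ, ∃ d : dm₂.Φ₀.obj Y, ∀ b ∈ dm₂.F₀ Y, ∃ n : ℤ,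
      dm₂.div₀ Y b = Algebra.GrothendieckGroup.of d ^ n)
    (hZQ₂ : ∀ (W : D') (𝔭 : Primes (dm₂.Φ₀.obj (C₂.baseOp (op W)))),
      IsZMonoprime ↥𝔭.submonoid ∨ IsQMonoprime ↥𝔭.submonoid)
    (hsat₂ : ∀ (W : D'), ∀ x ∈ C₂.Φ.carrier (op W), ∃ (N : ℕ+) (d : dm₂.Φ₀.obj (C₂.baseOp (op W))),
      x ^ (N : ℕ) = (hpf₂ (C₂.baseOp (op W))).weak.toRealification (Perfection.of _ d)) :
    Literature.AnabelianGeometry.EtaleTheta.Cor38_i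
      (fun E _ => Literature.AlgebraicGeometry.Frobenioids.IsFrobeniusSlim E) h :=
  h.cor38_i_weak_of_criteria hF₁ hF₂
    (C₁.bsFldPreStepLimitCriterion_ofRlfQWeak_of_ratSupport hF₁ h34₁ hcyc₁ hZQ₁ hsat₁)
    (C₂.bsFldPreStepLimitCriterion_ofRlfQWeak_of_ratSupport hF₂ h34₂ hcyc₂ hZQ₂ hsat₂)

/-- **[EtTh] Cor. 3.8 (i) AS TYPED over the weak constructed `Λ = ℚ` data from NAMED `B₀`/`Φ₀`/`D`-LEVEL CLAUSES
ONLY** (canonical category vocabulary): `hF_i` ⟸ (`hB₀inj_i`, `hFSM_i`) through `isFrobenioid_of_structural` ∘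
`RealifiedDivisorMonoids.ofRlfQWeak_hBinj` (`B₀^ℚ = B₀^pf`: `hBinj` ⟸ `hB₀inj` by L1's `perfectionMap_injective`),
`hcyc_i` ⟸ `dm_i.Prop34Const`.  Inputs per side: `hB₀inj_i`, `hFSM_i`, `dm_i.Prop34`, `dm_i.Prop34Const`, `hZQ_i`,
`hsat_i`. [cite: MochizukiEtTh2009, Cor 3.8 p.80] -/
theorem cor38_i_ofRlfQWeak_of_structural
    {C₁ : TemperedFrobenioid (RealifiedDivisorMonoids.ofRlfQWeak dm₁ hpf₁) D
      (treeCatVocab D IsRational IsStrictlyRational)}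
    {C₂ : TemperedFrobenioid (RealifiedDivisorMonoids.ofRlfQWeak dm₂ hpf₂) D'
      (treeCatVocab D' IsRational' IsStrictlyRational')}
    (h : Cor38Hyp C₁ C₂)
    (hB₀inj₁ : ∀ {Y Y' : D₀ᵒᵖ} (g : Y ⟶ Y'), Injective (dm₁.B₀.map g).hom)
    (hFSM₁ : ∀ {A B : D} (α : B ⟶ A), IsFSM α → IsIso α)
    (h34₁ : dm₁.Prop34 V₁ V₀₁) (hC₁ : dm₁.Prop34Const)
    (hZQ₁ : ∀ (W : D) (𝔭 : Primes (dm₁.Φ₀.obj (C₁.baseOp (op W)))),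
      IsZMonoprime ↥𝔭.submonoid ∨ IsQMonoprime ↥𝔭.submonoid)
    (hsat₁ : ∀ (W : D), ∀ x ∈ C₁.Φ.carrier (op W), ∃ (N : ℕ+) (d : dm₁.Φ₀.obj (C₁.baseOp (op W))),
      x ^ (N : ℕ) = (hpf₁ (C₁.baseOp (op W))).weak.toRealification (Perfection.of _ d))
    (hB₀inj₂ : ∀ {Y Y' : D₀'ᵒᵖ} (g : Y ⟶ Y'), Injective (dm₂.B₀.map g).hom)
    (hFSM₂ : ∀ {A B : D'} (α : B ⟶ A), IsFSM α → IsIso α)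
    (h34₂ : dm₂.Prop34 V₂ V₀₂) (hC₂ : dm₂.Prop34Const)
    (hZQ₂ : ∀ (W : D') (𝔭 : Primes (dm₂.Φ₀.obj (C₂.baseOp (op W)))),
      IsZMonoprime ↥𝔭.submonoid ∨ IsQMonoprime ↥𝔭.submonoid)
    (hsat₂ : ∀ (W : D'), ∀ x ∈ C₂.Φ.carrier (op W), ∃ (N : ℕ+) (d : dm₂.Φ₀.obj (C₂.baseOp (op W))),
      x ^ (N : ℕ) = (hpf₂ (C₂.baseOp (op W))).weak.toRealification (Perfection.of _ d)) :
    Literature.AnabelianGeometry.EtaleTheta.Cor38_i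
      (fun E _ => Literature.AlgebraicGeometry.Frobenioids.IsFrobeniusSlim E) h :=
  h.cor38_i_ofRlfQWeak_of_ratSupport
    (C₁.isFrobenioid_of_structural (RealifiedDivisorMonoids.ofRlfQWeak_hBinj dm₁ hpf₁ hB₀inj₁) hFSM₁)
    (C₂.isFrobenioid_of_structural (RealifiedDivisorMonoids.ofRlfQWeak_hBinj dm₂ hpf₂ hB₀inj₂) hFSM₂)
    h34₁ hC₁.hcyc hZQ₁ hsat₁ h34₂ hC₂.hcyc hZQ₂ hsat₂

end OfRlfWeak

end Cor38Hyp

end Literature.AnabelianGeometry.EtaleTheta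

end
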